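import Literature.Geometry.DiscreteGeometry.FejesTothTammesEight

/-!
# Schütte–van der Waerden's arrangements of seven and eight points: `d₇ ≥ √(3 − cot² 40°)`
# (`77°52′`) and `d₈ ≥ √((16 − 4√2)/7)` (`74°51.5′`) — proved

Topic `Literature/Geometry/DiscreteGeometry`.  Theorem-only companion of `RankinSimplexBound.lean`
(Tammes rows `N = 2, …, 6`), `TammesTwelveIcosahedron.lean` (`N = 12`) and
`FejesTothTammesEight.lean` (`d₈ ≤ √(3 − cot² 40°) < 1.2569`), in the vocabulary of
`SphericalCodeOptimal.lean` (`maxMinDist N E` = the chordal Tammes number `d_N`).  K. Schütte and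
B. L. van der Waerden (Math. Ann. 123 (1951) 96–124) determine the smallest sphere on which `7` resp.
`8` points with minimum distance `1` fit; this file formalises the two ARRANGEMENTS they print (the
achievability halves, as explicit coefficient tables over an orthonormal frame, through
`sqrt_le_maxMinDist_of_table`), not their minimality proofs (§8 pp. 102–104 for `N = 7`, §11
pp. 109–110 for `N = 8`, by the irreducible-graph method — NOT formalised here).

## Source, AS PRINTED [`SchutteVanderwaerden1951`] (read from the open GDZ scan PPN235181684_0123)

Normalisation (p. 100 (1), p. 101–102): minimum distance `δ = 1` on a sphere of radius `r`; `a` = the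
great-circle arc between two points at distance `1`, `sin (a/2) = 1/(2r)` (1); the size of the sphere
is measured by the angle `α` of the equilateral spherical triangle of side `a`, and
"(2) `cos a = cot α · cot (α/2) = cos α / (1 − cos α)`" (p. 102).  In the unit-sphere chordal
convention of this tree the Tammes value is `2 sin (a_N/2) = 2/d_N = √(2 − 2 cos a_N)`, where
`d² = 4r²` is the quantity tabulated in §18 (p. 124).

* `N = 7` (§7, p. 102, Fig. 8): "Auf einer Kugel mit `α = 80°` erhält man eine Verteilung von 7
  Punkten in folgender Weise: Man gehe aus von einem gleichseitigen sphärischen Dreieck `ABC` mit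
  Kantenlänge 1. Der Mittelpunkt des Dreiecks sei der Südpol der Kugel. Auf die drei Seiten setze man
  drei weitere gleichseitige Dreiecke auf. Die Spitzen `P, Q, R` dieser Dreiecke liegen gleich weit
  vom Nordpol entfernt. […] Es gibt also einen Augenblick, wo diese Entfernungen genau 1 geworden
  sind. […] Aus der Symmetrie der Figur ist klar, daß die Winkel zwischen den drei Kreisbogen in `S`
  genau `120°` sind. Da `ARSQ` ein sphärischer Rhombus ist, ist der Winkel `RAQ` ebenfalls `120°`. Die
  übrigen drei Winkel bei `A` sind gleich `α`, also hat man `120° + 3α = 360°`, `α = 80°`. Auf einer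
  Kugel mit `α = 80°` haben also 7 Punkte Platz, und für die Minimalkugel mit 7 Punkten gilt
  `α ≥ 80°`."  (§8, p. 104: "Die Minimalkugel für 7 Punkte ist also durch den Winkel `α = 80°`
  bestimmt" — the minimality, not formalised.)  §18 table: `N = 7 | d² = 2,532..`.
  By (2) at `α = 80°`: `cos a₇ = cos 80°/(1 − cos 80°) = cot 80° · cot 40° = 0.2101383…`,
  `a₇ = 77.8695° = 77°52′`, chord `√(2 − 2 cos a₇) = 1.2568705…`; and since
  `cot 80° cot 40° = (cot² 40° − 1)/2`, the chord equals `√(3 − cot² 40°)` — L. Fejes Tóth's bound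
  `√(3 − cot² ω_N)` at `N = 8` (`ω₈ = 40°`; `FejesTothTammesEight.lean`): in the §18 table the entry
  `2,532..` appears twice, as `d²` of row `7` and as Fejes Tóth's `d₀²` of row `8`.
* `N = 8` (§11, pp. 108–109, Fig. 20 = the square antiprism with all sixteen edges of length `1`):
  "Die Kugel, die durch den in Fig. 20 dargestellten halbregulären Körper mit 8 Ecken bestimmt wird,
  ist gekennzeichnet durch die Gleichung (10) `3α + β = 360°`, wo `β` der Winkel eines regelmäßigen
  Vierecks mit der Seite `a` ist. Zwischen `a` und `β` besteht die Beziehung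
  `cos a = cot² (β/2) = (1 + cos β)/(1 − cos β)` oder (11) `cos β = (cos a − 1)/(cos a + 1)`. […]
  `7 cos² a + 2 cos a − 1 = 0`, `cos a = (√8 − 1)/7`, `a > 74°`."  (p. 110: "d. h. die Kugel der
  Fig. 20 ist die Minimalkugel für `N = 8`" — the minimality, not formalised.)  §18 table:
  `N = 8 | d² = 2,707..`.  Chord: `√(2 − 2(√8 − 1)/7) = √((16 − 4√2)/7) = 1.2155625…`
  (`a₈ = 74.8585° = 74°51.5′`).

## What is proved

* `sqrt_le_maxMinDist_eight` — the SQUARE ANTIPRISM as a table (`t = √2`, `r² = (4 − t)/7`,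
  `z² = (2t − 1)/7`; rows `(±tr, 0, z), (0, ±tr, z), (±r, ±r, −z)`; the sixteen edges have inner
  product `z² = (√8 − 1)/7`, the other pairs less): `d₈ ≥ √(2 − 2(√8 − 1)/7)` in every real inner
  product space of dimension `≥ 3`; `lt_maxMinDist_eight` (`1.2155 < d₈`) and, with Fejes Tóth's
  bound, `maxMinDist_eight_mem_Ioo` : **`1.2155 < d₈ < 1.2569` on `S²`**.
* `sqrt_le_maxMinDist_seven` — the SEVEN-POINT FIGURE of Fig. 8 as a table (pole; `P, Q, R` at
  polar angle `a`, azimuths `0°, ±120°`; `A, B, C` at polar angle `b`, azimuths `180°, ±60°`;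
  `cos a = c := cos 80°/(1 − cos 80°)`, `cos b = (5c² − 1)/(1 + 3c²)`; the twelve edges of Fig. 8
  have inner product exactly `c` — for the triangle `ABC` this is the identity `3 cos² b − 1 = 2c`,
  which holds because `c` is a root of `3c³ − 9c² − 3c + 1`, i.e. because `cos 240° = −1/2`):
  `d₇ ≥ √(2 − 2·cos 80°/(1 − cos 80°))` in dimension `≥ 3`;
  `cot_mul_cot_half_eq_cos_div` ((2) at `α = 80°`), `three_sub_cot_sq_two_pi_div_nine_eq`
  (the value is Fejes Tóth's `N = 8` expression), `sqrt_three_sub_cot_sq_le_maxMinDist_seven`,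
  `lt_maxMinDist_seven` (**`1.2568 < d₇`**), `maxMinDist_eight_le_maxMinDist_seven`
  (`d₈ ≤ √(3 − cot² 40°) ≤ d₇`, through Fejes Tóth rather than by deleting a point), and the
  finite-set reading `exists_seven_sqrt_le_dist` (seven points of `S²` pairwise at chordal distance
  `≥ √(3 − cot² 40°) > 1.2568`, i.e. at angular distance `≥ 77°52′`, EXIST).

Everything is proved; no definitions, no named facts.  NOT here: `d₇ ≤ √(3 − cot² 40°)` and
`d₈ ≤ √((16 − 4√2)/7)` (the theorems of §8 and §11), uniqueness of the figures, `N = 9, 10, 11`.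

## References
* K. Schütte, B. L. van der Waerden, *Auf welcher Kugel haben 5, 6, 7, 8 oder 9 Punkte mit
  Mindestabstand Eins Platz?*, Math. Ann. 123 (1951) 96–124: §7 p. 102 (eq. (2), Fig. 8,
  `α = 80°`), §11 pp. 108–109 (eqs. (10)–(11), Fig. 20, `cos a = (√8 − 1)/7`), §18 table p. 124.
  [`SchutteVanderwaerden1951`]
* H. T. Croft, K. J. Falconer, R. K. Guy, *Unsolved Problems in Geometry* (1991), §D7 table
  (`7 | 77°52′ | (unique configuration)`, `8 | 74°52′ | square anti-prism`). [`CroftFalconerGuy1991`]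
* O. R. Musin, A. S. Tarasov, Proc. Steklov Inst. Math. 288 (2015) 117–131, Tables 7.2–7.3
  (`N = 7`: `d_max = 1.35908` rad; `N = 8`: `1.30653` rad). [`MusinTarasov2015`]
* L. Fejes [Tóth], Jber. Deutsch. Math.-Verein. 53 (1943) 66–68, (1). [`FejesToth1943Tammes`]
-/

noncomputable section

namespace Literature.Geometry.DiscreteGeometry

open RealInnerProductSpace Module Finset Real

universe u

variable {E : Type u} [NormedAddCommGroup E] [InnerProductSpace ℝ E]

/-! ### `N = 8`: the square antiprism of Fig. 20 -/

section Eight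

/-- `√8 = 2√2`. [folklore] -/
private theorem sqrt_eight_eq : Real.sqrt 8 = 2 * Real.sqrt 2 := by
  rw [show (8 : ℝ) = 2 ^ 2 * 2 by norm_num, Real.sqrt_mul (by norm_num), Real.sqrt_sq (by norm_num)]

/-- `1.41421 < √2`. [folklore] -/
private theorem lt_sqrt_two : (1.41421 : ℝ) < Real.sqrt 2 :=
  (Real.lt_sqrt (by norm_num)).2 (by norm_num)

/-- `√2 < 1.41422`. [folklore] -/
private theorem sqrt_two_lt : Real.sqrt 2 < 1.41422 :=
  (Real.sqrt_lt' (by norm_num)).2 (by norm_num)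

set_option maxHeartbeats 400000 in
-- `8 + 56` `fin_cases` branches, each a `simp` + `linarith` call: about 1.3× the default budget.
/-- **The square antiprism of Fig. 20** (all sixteen edges of the same length): with `t = √2`,
`r = √((4 − t)/7)`, `z = √((2t − 1)/7)`, the eight unit vectors `(±tr, 0, z)`, `(0, ±tr, z)`,
`(±r, ±r, −z)` over an orthonormal frame have pairwise inner products `≤ z² = (2√2 − 1)/7 =
(√8 − 1)/7` (`= cos a₈`, the root of `7x² + 2x − 1` printed on p. 109), with equality exactly
along the `8 + 8` edges of the two squares and of the zigzag; hence
`d₈ ≥ √(2 − 2(√8 − 1)/7) = √((16 − 4√2)/7)` (`= 1.2155625…`, angular `a₈ = 74.8585° = 74°51.5′`) in every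
real inner product space of dimension `≥ 3`.
[cite: SchutteVanderwaerden1951, §11 pp. 108–109 (Fig. 20, eqs. (10)–(11), cos a = (√8 − 1)/7)] -/
theorem sqrt_le_maxMinDist_eight [FiniteDimensional ℝ E] (h3 : 3 ≤ finrank ℝ E) :
    Real.sqrt (2 - 2 * ((Real.sqrt 8 - 1) / 7)) ≤ maxMinDist 8 E := by
  rw [sqrt_eight_eq]
  have ht1 := lt_sqrt_two
  have ht2 := sqrt_two_lt
  set t := Real.sqrt 2 with ht_def
  have ht : t * t = 2 := Real.mul_self_sqrt (by norm_num)
  set r := Real.sqrt ((4 - t) / 7) with hr_def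
  set z := Real.sqrt ((2 * t - 1) / 7) with hz_def
  have hr : r * r = (4 - t) / 7 := Real.mul_self_sqrt (by linarith)
  have hz : z * z = (2 * t - 1) / 7 := Real.mul_self_sqrt (by linarith)
  have htr2 : t * t * (r * r) = (8 - 2 * t) / 7 := by linear_combination (r * r) * ht + 2 * hr
  have htr : t * (r * r) = (4 * t - 2) / 7 := by linear_combination t * hr - (1 / 7 : ℝ) * ht
  have key := sqrt_le_maxMinDist_of_table (E := E) h3 (by norm_num : 2 ≤ 8)
    ![![t * r, 0, z], ![0, t * r, z], ![-(t * r), 0, z], ![0, -(t * r), z],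
      ![r, r, -z], ![-r, r, -z], ![-r, -r, -z], ![r, -r, -z]] ((2 * t - 1) / 7)
    (fun k => by fin_cases k <;> simp [Fin.sum_univ_three] <;> linarith [hr, hz, htr2])
    (fun k l hkl => by
      fin_cases k <;> fin_cases l <;>
        first
        | exact absurd rfl hkl
        | (simp [Fin.sum_univ_three]; linarith [hr, hz, htr2, htr, ht1, ht2]))
  exact key

/-- **`1.2155 < d₈`** on `S² ⊂ ℝ³` (`√((16 − 4√2)/7) = 1.2155625…`; `§18: d² = 2,707..`,
`2/√2.7071 = 1.21556`). [cite: SchutteVanderwaerden1951, §11 p. 109 and §18 table p. 124 (N = 8)] -/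
theorem lt_maxMinDist_eight : (1.2155 : ℝ) < maxMinDist 8 (EuclideanSpace ℝ (Fin 3)) := by
  refine lt_of_lt_of_le ?_ (sqrt_le_maxMinDist_eight (by rw [finrank_euclideanSpace_fin]))
  rw [sqrt_eight_eq]
  exact (Real.lt_sqrt (by norm_num)).2 (by linarith [sqrt_two_lt])

/-- **`1.2155 < d₈ < 1.2569`**: the square antiprism from below, L. Fejes Tóth's bound
`√(3 − cot² 40°)` (`maxMinDist_eight_lt`) from above; the true value `√((16 − 4√2)/7)` is the
lower end (Schütte–van der Waerden §11, not formalised).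
[cite: SchutteVanderwaerden1951, §11 and §18 table (N = 8: d² = 2,707.., d₀² = 2,532..)]
[cite: FejesToth1943Tammes, (1), n = 8] -/
theorem maxMinDist_eight_mem_Ioo :
    maxMinDist 8 (EuclideanSpace ℝ (Fin 3)) ∈ Set.Ioo (1.2155 : ℝ) 1.2569 :=
  ⟨lt_maxMinDist_eight, maxMinDist_eight_lt⟩

end Eight

/-! ### `N = 7`: the figure of Fig. 8 (`α = 80°`) -/

section Seven

/-- `cos 240° = −1/2` through the triple-angle formula: `4 cos³ 80° − 3 cos 80° = −1/2`.
[folklore] -/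
private theorem cos_four_pi_div_nine_cubic :
    4 * Real.cos (4 * π / 9) ^ 3 - 3 * Real.cos (4 * π / 9) = -(1 / 2) := by
  rw [← Real.cos_three_mul, show 3 * (4 * π / 9) = π / 3 + π by ring, Real.cos_add_pi,
    Real.cos_pi_div_three]

/-- `0 < cos 80°`. [folklore] -/
private theorem cos_four_pi_div_nine_pos : 0 < Real.cos (4 * π / 9) :=
  Real.cos_pos_of_mem_Ioo ⟨by linarith [pi_pos], by linarith [pi_pos]⟩

/-- `cos 80° < 1/4` (`cos 80° = 0.1736…`): `cos 80° < cos 60° = 1/2`, and on `[1/4, 1/2)` the cubic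
`8x³ − 6x + 1` is negative. [folklore] -/
private theorem cos_four_pi_div_nine_lt_quarter : Real.cos (4 * π / 9) < 1 / 4 := by
  have hlt : Real.cos (4 * π / 9) < 1 / 2 := by
    rw [← Real.cos_pi_div_three]
    exact Real.cos_lt_cos_of_nonneg_of_le_pi (by positivity) (by linarith [pi_pos])
      (by linarith [pi_pos])
  have h3 := cos_four_pi_div_nine_cubic
  have h0 := cos_four_pi_div_nine_pos
  set x := Real.cos (4 * π / 9) with hx
  by_contra hle
  push Not at hle
  have hq : 0 ≤ 6 - 8 * (x ^ 2 + x / 4 + 1 / 16) := by nlinarith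
  nlinarith [mul_nonneg (sub_nonneg.2 hle) hq]

/-- The parameters of the seven-point figure: `c = cos a = cos 80°/(1 − cos 80°)` (`0 < c < 1/3`,
`3c³ − 9c² − 3c + 1 = 0`), `s = sin a`, `u = cos b = (5c² − 1)/(1 + 3c²) < 0`, `w = sin b`, with
the two contact identities `3u² − 1 = 2c` (triangle `ABC`) and `s w = 2c(1 − u)` (edges apex–base,
used as `≤`). [folklore] -/
private theorem seven_params :
    ∃ c s u w : ℝ, c = Real.cos (4 * π / 9) / (1 - Real.cos (4 * π / 9)) ∧ 0 < c ∧ c < 1 / 3 ∧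
      u < 0 ∧ 3 * u * u - 1 = 2 * c ∧ s * s = 1 - c * c ∧ w * w = 1 - u * u ∧ 0 ≤ s * w ∧
      s * w ≤ 2 * c * (1 - u) := by
  have hx0 := cos_four_pi_div_nine_pos
  have hx4 := cos_four_pi_div_nine_lt_quarter
  have hx3 := cos_four_pi_div_nine_cubic
  set x := Real.cos (4 * π / 9) with hx_def
  set c := x / (1 - x) with hc_def
  have h1x : (1 - x) ≠ 0 := by
    intro h
    linarith
  have hcx : c * (1 - x) = x := div_mul_cancel₀ x h1x
  have hc0 : 0 < c := div_pos hx0 (by linarith)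
  have hc3 : c < 1 / 3 := by
    rw [hc_def, div_lt_iff₀ (by linarith)]
    linarith
  have hcub : 3 * c ^ 3 - 9 * c ^ 2 - 3 * c + 1 = 0 := by
    have h : (3 * c ^ 3 - 9 * c ^ 2 - 3 * c + 1) * (1 - x) ^ 3 = 0 := by
      linear_combination
        (3 * (c ^ 2 * (1 - x) ^ 2 + c * (1 - x) * x + x ^ 2) - 9 * (1 - x) * (c * (1 - x) + x) -
            3 * (1 - x) ^ 2) * hcx + 2 * hx3
    exact (mul_eq_zero.1 h).resolve_right (pow_ne_zero 3 h1x)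
  set u := (5 * c ^ 2 - 1) / (1 + 3 * c ^ 2) with hu_def
  have hden : 0 < 1 + 3 * c ^ 2 := by positivity
  have hu_mul : u * (1 + 3 * c ^ 2) = 5 * c ^ 2 - 1 := div_mul_cancel₀ _ hden.ne'
  have hu0 : u < 0 := div_neg_of_neg_of_pos (by nlinarith) hden
  have hu1 : -1 < u := by
    rw [hu_def, lt_div_iff₀ hden]
    nlinarith
  have hkey : 3 * u * u - 1 = 2 * c := by
    have h : (3 * u * u - 1 - 2 * c) * (1 + 3 * c ^ 2) ^ 2 = 0 := by
      have h' : (3 * u * u - 1 - 2 * c) * (1 + 3 * c ^ 2) ^ 2 =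
          3 * (5 * c ^ 2 - 1) ^ 2 - (2 * c + 1) * (1 + 3 * c ^ 2) ^ 2 := by
        linear_combination (3 * (u * (1 + 3 * c ^ 2)) + 3 * (5 * c ^ 2 - 1)) * hu_mul
      rw [h']
      linear_combination (-2 * (3 * c ^ 2 - 2 * c - 1)) * hcub
    have := (mul_eq_zero.1 h).resolve_right (pow_ne_zero 2 hden.ne')
    linarith
  have hcc : 0 ≤ 1 - c ^ 2 := by nlinarith
  have huu : 0 ≤ 1 - u ^ 2 := by nlinarith
  refine ⟨c, Real.sqrt (1 - c ^ 2), u, Real.sqrt (1 - u ^ 2), rfl, hc0, hc3, hu0, hkey, ?_, ?_,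
    by positivity, ?_⟩
  · rw [Real.mul_self_sqrt hcc]; ring
  · rw [Real.mul_self_sqrt huu]; ring
  · rw [← Real.sqrt_mul hcc]
    have hsq : (1 - c ^ 2) * (1 - u ^ 2) = (2 * c * (1 - u)) ^ 2 := by
      linear_combination (1 - u) * hu_mul
    rw [hsq, Real.sqrt_sq (by nlinarith)]

/-- **The seven-point figure of Fig. 8** (`α = 80°`; twelve edges `SP, SQ, SR`, `PB, PC, QA, QB,
RA, RC`, `AB, BC, CA`): with `c = cos 80°/(1 − cos 80°)` (`= cos a` by (2)), `s = √(1 − c²)`,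
`u = (5c² − 1)/(1 + 3c²)`, `w = √(1 − u²)`, the seven unit vectors `S = (0, 0, 1)`;
`P, Q, R = (s, 0, c), (−s/2, ±(√3/2)s, c)`; `A, B, C = (−w, 0, u), (w/2, ±(√3/2)w, u)` over an
orthonormal frame have pairwise inner products `≤ c`, with equality exactly along the twelve edges;
hence `d₇ ≥ √(2 − 2 cos 80°/(1 − cos 80°))` (`= 1.2568705…`, angular `a₇ = 77.8695° = 77°52′`)
in every real inner product space of dimension `≥ 3` ("Auf einer Kugel mit `α = 80°` haben also 7
Punkte Platz"). [cite: SchutteVanderwaerden1951, §7 p. 102 (eq. (2), Fig. 8, 120° + 3α = 360°, α = 80°)] -/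
theorem sqrt_le_maxMinDist_seven [FiniteDimensional ℝ E] (h3 : 3 ≤ finrank ℝ E) :
    Real.sqrt (2 - 2 * (Real.cos (4 * π / 9) / (1 - Real.cos (4 * π / 9)))) ≤ maxMinDist 7 E := by
  obtain ⟨c, s, u, w, hc, hc0, hc3, hu0, hkey, hs, hw, hsw0, hsw⟩ := seven_params
  rw [← hc]
  have h33 : Real.sqrt 3 * Real.sqrt 3 = 3 := Real.mul_self_sqrt (by norm_num)
  obtain ⟨v, hv⟩ : ∃ v : ℝ, v = Real.sqrt 3 / 2 * s := ⟨_, rfl⟩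
  obtain ⟨y, hy⟩ : ∃ y : ℝ, y = Real.sqrt 3 / 2 * w := ⟨_, rfl⟩
  have hvv : v * v = 3 / 4 * (s * s) := by rw [hv]; linear_combination (s * s / 4) * h33
  have hyy : y * y = 3 / 4 * (w * w) := by rw [hy]; linear_combination (w * w / 4) * h33
  have hvy : v * y = 3 / 4 * (s * w) := by rw [hv, hy]; linear_combination (s * w / 4) * h33
  have hA : 3 * (c * c) - 1 ≤ 2 * c := by nlinarith
  have hcu : c * u ≤ 0 := by nlinarith
  exact sqrt_le_maxMinDist_of_table (E := E) h3 (by norm_num : 2 ≤ 7)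
    ![![0, 0, 1], ![s, 0, c], ![-(s / 2), v, c], ![-(s / 2), -v, c],
      ![-w, 0, u], ![w / 2, y, u], ![w / 2, -y, u]] c
    (fun k => by fin_cases k <;> simp [Fin.sum_univ_three] <;> linarith [hs, hw, hvv, hyy])
    (fun k l hkl => by
      fin_cases k <;> fin_cases l <;>
        first
        | exact absurd rfl hkl
        | (simp [Fin.sum_univ_three] <;>
            linarith [hs, hw, hvv, hyy, hvy, hsw0, hsw, hu0, hc0, hA, hkey, hcu]))

/-- **(2) at `α = 80°`, as printed**: `cot α · cot (α/2) = cos α/(1 − cos α)`, i.e.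
`cos a₇ = cot 80° · cot 40° = cos 80°/(1 − cos 80°)`.
[cite: SchutteVanderwaerden1951, §7 p. 102, eq. (2)] -/
theorem cot_mul_cot_half_eq_cos_div :
    Real.cot (4 * π / 9) * Real.cot (2 * π / 9) =
      Real.cos (4 * π / 9) / (1 - Real.cos (4 * π / 9)) := by
  have hθ : 4 * π / 9 = 2 * (2 * π / 9) := by ring
  have hs : 0 < Real.sin (2 * π / 9) :=
    Real.sin_pos_of_pos_of_lt_pi (by positivity) (by linarith [pi_pos])
  have hc : 0 < Real.cos (2 * π / 9) :=
    Real.cos_pos_of_mem_Ioo ⟨by linarith [pi_pos], by linarith [pi_pos]⟩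
  have hs2 : Real.sin (2 * π / 9) ^ 2 = 1 - Real.cos (2 * π / 9) ^ 2 := Real.sin_sq _
  have hc1 : Real.cos (2 * π / 9) < 1 := by
    have h := Real.cos_lt_cos_of_nonneg_of_le_pi le_rfl (by linarith [pi_pos])
      (by positivity : (0 : ℝ) < 2 * π / 9)
    rwa [Real.cos_zero] at h
  rw [Real.cot_eq_cos_div_sin, Real.cot_eq_cos_div_sin, hθ, Real.sin_two_mul, Real.cos_two_mul]
  have h1 : 1 - (2 * Real.cos (2 * π / 9) ^ 2 - 1) ≠ 0 := by nlinarith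
  have h2 : 2 * Real.sin (2 * π / 9) * Real.cos (2 * π / 9) ≠ 0 :=
    (mul_pos (mul_pos two_pos hs) hc).ne'
  rw [div_mul_div_comm, div_eq_div_iff (mul_ne_zero h2 hs.ne') h1]
  have hs3 : Real.sin (2 * π / 9) * Real.sin (2 * π / 9) = 1 - Real.cos (2 * π / 9) ^ 2 := by
    rw [← hs2]; ring
  linear_combination (-(2 : ℝ) * Real.cos (2 * π / 9) * (2 * Real.cos (2 * π / 9) ^ 2 - 1)) * hs3

/-- **The seven-point value is Fejes Tóth's bound for eight points**:
`2 − 2·cos 80°/(1 − cos 80°) = 3 − cot² 40°` (`cos 80° = 2 cos² 40° − 1`; both sides equal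
`(3 − 4 cos² 40°)/(1 − cos² 40°)`) — the `2,532..` printed twice in the §18 table (`d²` of row 7,
`d₀²` of row 8). [cite: SchutteVanderwaerden1951, §18 table p. 124 (N = 7: d² = 2,532..; N = 8: d₀² = 2,532..)] -/
theorem three_sub_cot_sq_two_pi_div_nine_eq :
    3 - Real.cot (2 * π / 9) ^ 2 = 2 - 2 * (Real.cos (4 * π / 9) / (1 - Real.cos (4 * π / 9))) := by
  have hθ : 4 * π / 9 = 2 * (2 * π / 9) := by ring
  have hs : 0 < Real.sin (2 * π / 9) :=
    Real.sin_pos_of_pos_of_lt_pi (by positivity) (by linarith [pi_pos])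
  have hc : 0 < Real.cos (2 * π / 9) :=
    Real.cos_pos_of_mem_Ioo ⟨by linarith [pi_pos], by linarith [pi_pos]⟩
  have hc1 : Real.cos (2 * π / 9) < 1 := by
    have h := Real.cos_lt_cos_of_nonneg_of_le_pi le_rfl (by linarith [pi_pos])
      (by positivity : (0 : ℝ) < 2 * π / 9)
    rwa [Real.cos_zero] at h
  have hs2 : Real.sin (2 * π / 9) ^ 2 = 1 - Real.cos (2 * π / 9) ^ 2 := Real.sin_sq _
  rw [hθ, Real.cos_two_mul, Real.cot_eq_cos_div_sin, div_pow, hs2]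
  have h1 : 1 - Real.cos (2 * π / 9) ^ 2 ≠ 0 := by nlinarith
  have h2 : 1 - (2 * Real.cos (2 * π / 9) ^ 2 - 1) ≠ 0 := by nlinarith
  field_simp
  ring

/-- Hence **`d₇ ≥ √(3 − cot² 40°)`** (dimension `≥ 3`): the seven-point figure reaches Fejes Tóth's
eight-point bound. [cite: SchutteVanderwaerden1951, §7 p. 102 and §18 table p. 124] -/
theorem sqrt_three_sub_cot_sq_le_maxMinDist_seven [FiniteDimensional ℝ E] (h3 : 3 ≤ finrank ℝ E) :
    Real.sqrt (3 - Real.cot (2 * π / 9) ^ 2) ≤ maxMinDist 7 E := by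
  rw [three_sub_cot_sq_two_pi_div_nine_eq]
  exact sqrt_le_maxMinDist_seven h3

/-- **`1.2568 < d₇`** on `S² ⊂ ℝ³` (`√(3 − cot² 40°) = 1.2568705…`; angular: seven points pairwise
`≥ 77.8695°` apart exist). [cite: SchutteVanderwaerden1951, §7 p. 102 (α = 80°) and §18 table (N = 7: d² = 2,532..)]
[cite: CroftFalconerGuy1991, §D7 table (7 | 77°52′)] -/
theorem lt_maxMinDist_seven : (1.2568 : ℝ) < maxMinDist 7 (EuclideanSpace ℝ (Fin 3)) :=
  sqrt_three_sub_cot_sq_two_pi_div_nine_mem_Ioo.1.trans_le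
    (sqrt_three_sub_cot_sq_le_maxMinDist_seven (by rw [finrank_euclideanSpace_fin]))

/-- **`d₈ ≤ √(3 − cot² 40°) ≤ d₇` on `S²`** — Fejes Tóth's bound for eight points sits between the
two Tammes numbers (here obtained through the bound, not by deleting a point).
[cite: FejesToth1943Tammes, (1), n = 8] [cite: SchutteVanderwaerden1951, §18 table (rows 7, 8)] -/
theorem maxMinDist_eight_le_maxMinDist_seven :
    maxMinDist 8 (EuclideanSpace ℝ (Fin 3)) ≤ maxMinDist 7 (EuclideanSpace ℝ (Fin 3)) :=
  maxMinDist_eight_le_sqrt.trans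
    (sqrt_three_sub_cot_sq_le_maxMinDist_seven (by rw [finrank_euclideanSpace_fin]))

/-- **Finite-set reading**: there are seven points of the unit sphere of `ℝ³` with pairwise
(chordal) distances `≥ √(3 − cot² 40°)` (`> 1.2568`; angular `≥ 77°52′`) — "Auf einer Kugel mit
`α = 80°` haben also 7 Punkte Platz". [cite: SchutteVanderwaerden1951, §7 p. 102] -/
theorem exists_seven_sqrt_le_dist :
    ∃ T : Finset (EuclideanSpace ℝ (Fin 3)), T.card = 7 ∧ (∀ v ∈ T, ‖v‖ = 1) ∧
      ∀ v ∈ T, ∀ w ∈ T, v ≠ w → Real.sqrt (3 - Real.cot (2 * π / 9) ^ 2) ≤ dist v w := by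
  obtain ⟨x, hx, hxd⟩ := exists_minDist_eq_maxMinDist (E := EuclideanSpace ℝ (Fin 3)) 7
  have hle : Real.sqrt (3 - Real.cot (2 * π / 9) ^ 2) ≤ minDist x := by
    rw [hxd]
    exact sqrt_three_sub_cot_sq_le_maxMinDist_seven (by rw [finrank_euclideanSpace_fin])
  have hne : (distinctPairs 7).Nonempty := distinctPairs_nonempty (i := 0) (j := 1) (by decide)
  exact exists_finset_of_le_minDist hx hne
    (lt_trans (by norm_num) sqrt_three_sub_cot_sq_two_pi_div_nine_mem_Ioo.1) hle

end Seven

end Literature.Geometry.DiscreteGeometry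

end
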